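import Summits.QuantumFields.BalabanUV.Beta.GAN24.WoodburyFibreGaugeSection
import Literature.MathematicalPhysics.QuantumFieldTheory.Balaban1983to89.B5Decay126

/-!
# Beta / GAN24 / WoodburyFibreGaugeDecay — the CERTIFIED BOUND ON THE FIBRE CORRECTION: exponential decay of the
Landau-gauge scalar operator `Γ·coproj ℋ·Γ` from the decay of King's one-form `Γ`, `ℋ` alone (census row V9, part 1)

Cell `pub-balaban`, β sub-cell, BINDER ROW **G-an2-4 ∕ (CONV-C)** («NOT IN PRINT; our proof attempt»), prover part **P3 =
WOODBURY-FIBRE reduction** (lineage `b2b-balaban-gan24-p3`, gen 5).  HONEST FRAMING (verbatim): discharging `BetaPertH`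
makes Bałaban's UV stability UNCONDITIONAL — a real constructive-QFT result; it is NOT the continuum limit and NOT the Clay
problem.  HONEST DEPENDENCY: continuum YM on T⁴ ⇐ BetaPertH ∧ nine spine estimates (0/9 proved); BetaPertH ⇐ (D1) ∧ (D4) ∧
CAP+tail; G-an2-4 gates asym, D1 and NE2/3/4.  THIS FILE DISCHARGES NOTHING of (CONV-C) or `BetaPertH`; `[folklore]`
bookkeeping over two tree modules consumed BY NAME: `GAN24/WoodburyFibreGaugeSection` (R17: `flucCov (L·L + QᴴT₂Q) Q =
Γ·coproj ℋ·Γ`, capacitance `ℋᴴℋ ⪰ (QQᴴ)⁻¹`) and the b05 lineage's positioned decay calculus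
`Balaban1983to89.B5Decay126` (`PosDecay.mul`, `PosDecay.inv` = the finite Combes–Thomas `QGQInverse.inverse_decay`).

## What is here

Real data: a carrier `X` with a pseudo-distance `dX`, fine indices `ι` at positions `π : ι → X` (profile `K₁`), block
indices `κ` at `σ : κ → X` (profile `K₂`); matrices `Γ : ι × ι`, `ℋ : ι × κ`.
* §1 `posDecay_sub` (difference of two decaying kernels), `posDecay_conjTranspose` (real `ᴴ = ᵀ`).
* §2 **`posDecay_sandwich_coproj`**: if `Γ` and `ℋ` decay at rate `δ > 0` (constants `cΓ`, `cH`) and the Gram matrix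
  `ℋᴴℋ` is coercive with `γ > 0`, then `Γ·coproj ℋ·Γ = Γ·Γ − Γ·ℋ·(ℋᴴℋ)⁻¹·ℋᴴ·Γ` decays at the rate
  `δ₁/8`, `δ₁ = B4Sect5Torus.rate K₂ γ (cH²K₁(δ/2)) (δ/2)`, with an EXPLICIT constant polynomial in
  `cΓ, cH, 2/γ, K₁(·), K₂(·)` — five `PosDecay.mul` steps and one `PosDecay.inv`; `posDecay_sandwich_coproj_shape`
  (`∃ δ′ > 0, ∃ C`).  N-UNIFORMITY READING (King's normalisation, blocks of `N^d` sites): `cΓ ≍ N^{−d}`, `cH ≍ 1`,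
  `K₁ ≍ N^d·K`, `K₂ ≍ K`, `γ = N^d` (`gram_minimiser_form_ge` with `QQᴴ = N^{−d}`): the Gram constant `cH²K₁` and `γ`
  scale alike, `rate K₂ (N^dγ̂) (N^dĉ) δ ≥ rate K₂ γ̂ ĉ δ` (monotone in the common factor ≥ 1, `rate_mono_scale`), and the
  output constant is `≍ N^{−d}` = the natural size of a fine-level covariance — every `N` enters through the INPUT
  constants only.
* §3 **`posDecay_flucCov_sq`**: the same bound transported to `flucCov (L·L + QᴴT₂Q) Q` by R17 (`flucCov_sq_reg`), with
  the Gram coercivity DERIVED from `Coercive (QQᴴ)⁻¹ γ` (`gram_minimiser_form_ge`) — i.e. the decay of the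
  block-constrained inverse of the SQUARED form (Bałaban's Landau-type block gauge operator [B5 (1.24)–(1.28) p.22];
  an2's `BiLaplaceBlockKKT.Sb`) follows from the FINE-LEVEL decay of King's scalar fluctuation covariance `Γ` and
  minimiser `ℋ` and nothing else.

NOT here (census row V9, part 2 = the typed residual): the fine-level, `N`-uniform decay of King's scalar `Γ`, `ℋ` on the
torus ∕ `ℤ^{d+1}` (printed and reproduced in the tree for Bałaban's normalisation: `B4Thm110ZeroBox` (G on boxes),
`B4Torus248Decay` (`G_jQ_j^*` on tori), `B5Hk103ScalarZd` (`ℋ = GQ*(QGQ*)⁻¹` on `ℤ^d`, mesh-free); `Γ = (1 − ℋQ)·G`) and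
the dictionary from those lattice operators to positioned matrices — an2's ∕ the consumer's, as for R16.
-/

namespace Summit.QuantumFields.BalabanUV.Beta.GAN24.WoodburyFibreGaugeDecay

open Matrix
open Literature.MathematicalPhysics.QuantumFieldTheory.Balaban1983to89
open B4Sect5Torus (IsPseudoDist rate weightC)
open B5Decay126 (PosDecay PosProfile)
open Summit.QuantumFields.BalabanUV.Beta.PropagatorWoodburyFibre
open Summit.QuantumFields.BalabanUV.Beta.GAN24.WoodburyFibreGaugeSection

noncomputable section

variable {X : Type*} {dX : X → X → ℝ}
variable {ι κ : Type*} [Fintype ι] [Fintype κ] [DecidableEq ι] [DecidableEq κ]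

/-! ## §1 Two small additions to the positioned decay calculus -/

omit [Fintype ι] [Fintype κ] [DecidableEq ι] [DecidableEq κ] in
/-- Difference of two decaying kernels (common rate `δ ≤ δ₁, δ₂`, nonnegative distances). [folklore] -/
theorem posDecay_sub (hd : IsPseudoDist dX) {pa : ι → X} {pb : κ → X} {A B : Matrix ι κ ℝ} {c₁ c₂ δ₁ δ₂ δ : ℝ}
    (hA : PosDecay dX pa pb A c₁ δ₁) (hB : PosDecay dX pa pb B c₂ δ₂) (h₁ : δ ≤ δ₁) (h₂ : δ ≤ δ₂) :
    PosDecay dX pa pb (A - B) (c₁ + c₂) δ := by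
  have hA' := B5Decay126.PosDecay.mono (fun x y => hd.nonneg x y) hA h₁
  have hB' := B5Decay126.PosDecay.mono (fun x y => hd.nonneg x y) hB h₂
  refine ⟨add_nonneg hA.1 hB.1, fun a b => ?_⟩
  rw [Matrix.sub_apply]
  calc |A a b - B a b| ≤ |A a b| + |B a b| := abs_sub _ _
    _ ≤ c₁ * Real.exp (-(δ * dX (pa a) (pb b))) + c₂ * Real.exp (-(δ * dX (pa a) (pb b))) :=
        add_le_add (hA'.2 a b) (hB'.2 a b)
    _ = (c₁ + c₂) * Real.exp (-(δ * dX (pa a) (pb b))) := by ring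

omit [Fintype ι] [Fintype κ] [DecidableEq ι] [DecidableEq κ] in
/-- Real conjugate transpose of a decaying kernel (symmetric distance). [folklore] -/
theorem posDecay_conjTranspose (hd : IsPseudoDist dX) {pa : ι → X} {pb : κ → X} {A : Matrix ι κ ℝ} {c δ : ℝ}
    (hA : PosDecay dX pa pb A c δ) : PosDecay dX pb pa Aᴴ c δ := by
  rw [conjTranspose_eq_transpose_of_trivial]
  exact B5Decay126.PosDecay.transpose hd.symm hA

/-- `rate` is monotone in a common scale factor `s ≥ 1` of (coercivity, constant): `rate K γ c δ ≤ rate K (sγ) (sc) δ` —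
the N-uniformity of the Gram-inverse rate when `γ` and the Gram constant both carry `N^d`. [folklore] -/
theorem rate_mono_scale (K : ℝ → ℝ) {γ c δ s : ℝ} (hγ : 0 ≤ γ) (hc : 0 ≤ c) (hδ : 0 < δ) (hK : 0 ≤ K (δ / 2))
    (hs : 1 ≤ s) : rate K γ c δ ≤ rate K (s * γ) (s * c) δ := by
  unfold rate weightC
  refine min_le_min le_rfl ?_
  have hw : 0 ≤ c * (4 / δ) * K (δ / 2) := by positivity
  have h1 : 0 < 2 * (c * (4 / δ) * K (δ / 2)) + 1 := by positivity
  have h2 : 0 < 2 * (s * c * (4 / δ) * K (δ / 2)) + 1 := by positivity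
  rw [div_le_div_iff₀ h1 h2]
  nlinarith [mul_nonneg hγ hw, mul_nonneg (sub_nonneg.mpr hs) (mul_nonneg hγ hw), mul_nonneg (sub_nonneg.mpr hs) hγ]

/-! ## §2 The sandwich `Γ·coproj ℋ·Γ` decays when `Γ` and `ℋ` do -/

/-- **DECAY OF THE FIBRE CORRECTION AND OF THE SANDWICH**: `Γ`, `ℋ` decaying at rate `δ` (constants `cΓ`, `cH`), Gram
matrix `ℋᴴℋ` coercive with `γ > 0`, profiles `K₁` (fine) and `K₂` (blocks) ⟹ `Γ·coproj ℋ·Γ` decays at rate `δ₁/8`,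
`δ₁ := rate K₂ γ (cH·cH·K₁(δ/2)) (δ/2)`, with the displayed constant. [folklore] -/
theorem posDecay_sandwich_coproj (hd : IsPseudoDist dX) {π : ι → X} {σ : κ → X} {K₁ K₂ : ℝ → ℝ}
    (hK₁0 : ∀ t, 0 < t → 0 ≤ K₁ t) (hK₁ : PosProfile dX π K₁) (hK₂0 : ∀ t, 0 < t → 0 ≤ K₂ t) (hK₂ : PosProfile dX σ K₂)
    {Γ : Matrix ι ι ℝ} {ℋ : Matrix ι κ ℝ} {cΓ cH δ γ : ℝ} (hδ : 0 < δ) (hγ : 0 < γ)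
    (hΓ : PosDecay dX π π Γ cΓ δ) (hℋ : PosDecay dX π σ ℋ cH δ) (hco : QGQInverse.Coercive (ℋᴴ * ℋ) γ) :
    PosDecay dX π π (Γ * coproj ℋ * Γ)
      (cΓ * cΓ * K₁ (δ / 2)
        + cΓ * cH * K₁ (δ / 2) * (2 / γ) * K₂ (rate K₂ γ (cH * cH * K₁ (δ / 2)) (δ / 2) / 2) * cH
            * K₂ (rate K₂ γ (cH * cH * K₁ (δ / 2)) (δ / 2) / 4) * cΓ
            * K₁ (rate K₂ γ (cH * cH * K₁ (δ / 2)) (δ / 2) / 8))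
      (rate K₂ γ (cH * cH * K₁ (δ / 2)) (δ / 2) / 8) := by
  set δ₁ := rate K₂ γ (cH * cH * K₁ (δ / 2)) (δ / 2) with hδ₁
  have hℋt : PosDecay dX σ π ℋᴴ cH δ := posDecay_conjTranspose hd hℋ
  -- the Gram matrix decays (sum over fine sites) and its inverse decays (finite Combes–Thomas on the blocks)
  have hS : PosDecay dX σ σ (ℋᴴ * ℋ) (cH * cH * K₁ (δ / 2)) (δ / 2) :=
    B5Decay126.PosDecay.mul hd hK₁0 hK₁ hℋt hℋ (by positivity) (half_pos hδ) (by linarith) (by linarith)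
  have hSi : PosDecay dX σ σ (ℋᴴ * ℋ)⁻¹ (2 / γ) δ₁ :=
    B5Decay126.PosDecay.inv hd hK₂0 hK₂ hγ (half_pos hδ) hS hco
  have hδ₁pos : 0 < δ₁ := B4Sect5Torus.rate_pos hK₂0 hγ hS.1 (half_pos hδ)
  have hδ₁le : δ₁ ≤ δ / 2 / 4 := B4Sect5Torus.rate_le_quarter K₂ γ _
  -- the chain Γ·ℋ·(ℋᴴℋ)⁻¹·ℋᴴ·Γ
  have h1 : PosDecay dX π σ (Γ * ℋ) (cΓ * cH * K₁ (δ / 2)) (δ / 2) :=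
    B5Decay126.PosDecay.mul hd hK₁0 hK₁ hΓ hℋ (by positivity) (half_pos hδ) (by linarith) (by linarith)
  have h2 : PosDecay dX π σ (Γ * ℋ * (ℋᴴ * ℋ)⁻¹) (cΓ * cH * K₁ (δ / 2) * (2 / γ) * K₂ (δ₁ / 2)) (δ₁ / 2) :=
    B5Decay126.PosDecay.mul hd hK₂0 hK₂ h1 hSi (by positivity) (half_pos hδ₁pos) (by linarith) (by linarith)
  have h3 : PosDecay dX π π (Γ * ℋ * (ℋᴴ * ℋ)⁻¹ * ℋᴴ)
      (cΓ * cH * K₁ (δ / 2) * (2 / γ) * K₂ (δ₁ / 2) * cH * K₂ (δ₁ / 4)) (δ₁ / 4) :=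
    B5Decay126.PosDecay.mul hd hK₂0 hK₂ h2 hℋt (by positivity) (by positivity : 0 < δ₁ / 4) (by linarith)
      (by linarith)
  have h4 : PosDecay dX π π (Γ * ℋ * (ℋᴴ * ℋ)⁻¹ * ℋᴴ * Γ)
      (cΓ * cH * K₁ (δ / 2) * (2 / γ) * K₂ (δ₁ / 2) * cH * K₂ (δ₁ / 4) * cΓ * K₁ (δ₁ / 8)) (δ₁ / 8) :=
    B5Decay126.PosDecay.mul hd hK₁0 hK₁ h3 hΓ (by positivity) (by positivity : 0 < δ₁ / 8) (by linarith)
      (by linarith)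
  have h0 : PosDecay dX π π (Γ * Γ) (cΓ * cΓ * K₁ (δ / 2)) (δ / 2) :=
    B5Decay126.PosDecay.mul hd hK₁0 hK₁ hΓ hΓ (by positivity) (half_pos hδ) (by linarith) (by linarith)
  -- the algebra: Γ·coproj ℋ·Γ = Γ·Γ − Γ·ℋ·(ℋᴴℋ)⁻¹·ℋᴴ·Γ
  have halg : Γ * coproj ℋ * Γ = Γ * Γ - Γ * ℋ * (ℋᴴ * ℋ)⁻¹ * ℋᴴ * Γ := by
    rw [coproj, Matrix.mul_sub, Matrix.mul_one, Matrix.sub_mul]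
    simp only [Matrix.mul_assoc]
  rw [halg]
  exact posDecay_sub hd h0 h4 (by linarith) le_rfl

/-- The `∃ δ′ > 0, ∃ C ≥ 0` shape of `posDecay_sandwich_coproj`. [folklore] -/
theorem posDecay_sandwich_coproj_shape (hd : IsPseudoDist dX) {π : ι → X} {σ : κ → X} {K₁ K₂ : ℝ → ℝ}
    (hK₁0 : ∀ t, 0 < t → 0 ≤ K₁ t) (hK₁ : PosProfile dX π K₁) (hK₂0 : ∀ t, 0 < t → 0 ≤ K₂ t) (hK₂ : PosProfile dX σ K₂)
    {Γ : Matrix ι ι ℝ} {ℋ : Matrix ι κ ℝ} {cΓ cH δ γ : ℝ} (hδ : 0 < δ) (hγ : 0 < γ)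
    (hΓ : PosDecay dX π π Γ cΓ δ) (hℋ : PosDecay dX π σ ℋ cH δ) (hco : QGQInverse.Coercive (ℋᴴ * ℋ) γ) :
    ∃ δ' C : ℝ, 0 < δ' ∧ PosDecay dX π π (Γ * coproj ℋ * Γ) C δ' := by
  have h := posDecay_sandwich_coproj hd hK₁0 hK₁ hK₂0 hK₂ hδ hγ hΓ hℋ hco
  have hS : PosDecay dX σ σ (ℋᴴ * ℋ) (cH * cH * K₁ (δ / 2)) (δ / 2) :=
    B5Decay126.PosDecay.mul hd hK₁0 hK₁ (posDecay_conjTranspose hd hℋ) hℋ (by positivity) (half_pos hδ)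
      (by linarith) (by linarith)
  exact ⟨_, _, by have := B4Sect5Torus.rate_pos hK₂0 hγ hS.1 (half_pos hδ); positivity, h⟩

/-! ## §3 Transport to the block-constrained inverse of the squared form (R17) -/

/-- **DECAY OF THE LANDAU-GAUGE SCALAR OPERATOR FROM KING'S ONE-FORM OBJECTS**: for real symmetric `L`, `T` with
`H_T = L + QᴴTQ`, its pivot and `QQᴴ` units, `(QQᴴ)⁻¹` coercive with `γ > 0`, and the one-form fluctuation covariance
`Γ = flucCov H_T Q` and minimiser `ℋ = minimiser H_T Q` decaying at rate `δ > 0` at fine level: every admissible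
regularised squared form has `flucCov (L·L + QᴴT₂Q) Q` decaying at rate `δ₁/8` with the constant of §2 — by
`flucCov_sq_reg` (R17) and `gram_minimiser_form_ge` (capacitance coercive). [folklore] -/
theorem posDecay_flucCov_sq (hd : IsPseudoDist dX) {π : ι → X} {σ : κ → X} {K₁ K₂ : ℝ → ℝ}
    (hK₁0 : ∀ t, 0 < t → 0 ≤ K₁ t) (hK₁ : PosProfile dX π K₁) (hK₂0 : ∀ t, 0 < t → 0 ≤ K₂ t) (hK₂ : PosProfile dX σ K₂)
    {L : Matrix ι ι ℝ} {Q : Matrix κ ι ℝ} {T : Matrix κ κ ℝ} (hL : Lᴴ = L) (hT : Tᴴ = T)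
    (hHT : IsUnit (L + Qᴴ * T * Q)) (hP : IsUnit (pivot (L + Qᴴ * T * Q) Q)) (hQ : IsUnit (Q * Qᴴ))
    {γ : ℝ} (hγ : 0 < γ) (hγQ : QGQInverse.Coercive (Q * Qᴴ)⁻¹ γ)
    {cΓ cH δ : ℝ} (hδ : 0 < δ) (hΓ : PosDecay dX π π (flucCov (L + Qᴴ * T * Q) Q) cΓ δ)
    (hℋ : PosDecay dX π σ (minimiser (L + Qᴴ * T * Q) Q) cH δ)
    (T₂ : Matrix κ κ ℝ) (hHT₂ : IsUnit (L * L + Qᴴ * T₂ * Q)) (hP₂ : IsUnit (pivot (L * L + Qᴴ * T₂ * Q) Q)) :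
    PosDecay dX π π (flucCov (L * L + Qᴴ * T₂ * Q) Q)
      (cΓ * cΓ * K₁ (δ / 2)
        + cΓ * cH * K₁ (δ / 2) * (2 / γ) * K₂ (rate K₂ γ (cH * cH * K₁ (δ / 2)) (δ / 2) / 2) * cH
            * K₂ (rate K₂ γ (cH * cH * K₁ (δ / 2)) (δ / 2) / 4) * cΓ
            * K₁ (rate K₂ γ (cH * cH * K₁ (δ / 2)) (δ / 2) / 8))
      (rate K₂ γ (cH * cH * K₁ (δ / 2)) (δ / 2) / 8) := by
  have hHh : (L + Qᴴ * T * Q).IsHermitian := isHermitian_reg hL hT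
  have hco : QGQInverse.Coercive ((minimiser (L + Qᴴ * T * Q) Q)ᴴ * minimiser (L + Qᴴ * T * Q) Q) γ :=
    fun x => (hγQ x).trans (gram_minimiser_form_ge hHh hP hQ x)
  have hG : IsUnit ((minimiser (L + Qᴴ * T * Q) Q)ᴴ * minimiser (L + Qᴴ * T * Q) Q) :=
    QGQInverse.isUnit_of_coercive hγ hco
  rw [flucCov_sq_reg hL hT hHT hP hG T₂ hHT₂ hP₂]
  exact posDecay_sandwich_coproj hd hK₁0 hK₁ hK₂0 hK₂ hδ hγ hΓ hℋ hco

end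

end Summit.QuantumFields.BalabanUV.Beta.GAN24.WoodburyFibreGaugeDecay
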